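import Summits.QuantumFields.YangMills.Theorems.FlatTubeReductionExactDressing
import Summits.QuantumFields.YangMills.Theorems.FlatTubeReductionExactDressingNumerology
import Summits.QuantumFields.YangMills.Theorems.FlatTubeReductionProfileInterfaceTail
import Summits.QuantumFields.YangMills.Theorems.FlatTubeReductionProfileInterfaceSlowTail
import HarnessLib

/-!
# THE EXACT DRESSING FROM SCALAR PROFILE NUMBERS: the `W`-fields of `RateTube.AnalyticRatePotInput` (+ the `O(λ_b²)` slack for `hT`) for the dressing
# `W̃ β = clampW κ (f_β/f_β(1)) (min(d_tor,½))` of ANY profile family whose seven scalar numbers are β-uniform — no moment/tail/measure hypothesis is left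
# (route `FlatTubeReduction`, crux K1 `NearFlatRatioLaw` stmt-QuantumFields-24720; seat `ym-line-ftr-p1` g14; rate twin «ratepack-v3 / frozen fibres»; R2b1 RECORD rung — no summit
# statement is proved here)

WHY (memo `Cruxes/NearFlatRatioLaw/Lines/ratepack-v3-frozen-g12.md` §7; this is F8d-4 = `exactDressing_fields` ∘ (`profile_moment_number`, `profile_reference_tail`, `profile_slow_tail`) with
the FP window `ε(β) = (√β)⁻¹`, the level `T = β^{1/8}`, the auxiliary slow level `D = T/(4β)` and the fibre core `C_β ⊆ {cap, ‖v̂‖, |v_{e,c}| ≤ (√β)⁻¹}`; numerology in `…ExactDressingNumerology`).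
* `stepActionErr_mono_right`;
* ★★★★ `exactDressing_of_profileNumbers` — INPUT: a colour-blind cap-supported profile family `Ω β` with coordinate radius `R_τ(β) ≤ 1/30` compatible with the window
  (`R_τ ≤ 1/30` and `β·E(R_τ, 12L³δ₁⁴) ≤ 1` eventually), measurable fibre cores `C_β`, and, eventually in `β`, the SEVEN SCALAR facts `θ_β = ∫_{C_β}Ω > 0`, `∫Ω ≤ Aθ`, `∫Ω(√β‖v̂‖)^{3n} ≤ Aθ`, `∫Ω̃₄ ≤ Aθ`,
  `∫Ω̃₄(√β‖v̂‖)^{3n} ≤ Aθ`, fibre tails at `T = β^{1/8}` `≤ t(β)θ` with `t(β) ≤ A_t e^{−c_tβ^{1/8}}`; OUTPUT: the conclusion of `exactDressing_fields` (all five `W`-fields for every `β`, slack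
  `ε_W = O(λ_b²)` eventually).  For the frozen stiff Gaussian at scale `β^{-1/2}` these seven numbers are elementary Gaussian integrals.
HONEST FRAMING: assembly; the other analytic fields of `AnalyticRatePotInput` (hT near/far at rate, hODpot, hST, hN) and the profile choice remain open; femto rung R2b1 (RECORD label);
not infinite volume, not a gap, not Clay.  No defs, no named facts, no `sorry`.
-/

set_option autoImplicit false

noncomputable section

open MeasureTheory Filter Topology Real Set
open scoped BigOperators
open Literature.MathematicalPhysics.QuantumFieldTheory
open Literature.MathematicalPhysics.QuantumLattice

namespace Summit.QuantumFields.YangMills.Theorems.FemtoTransferGap.RateTube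

open Summit.QuantumFields.YangMills.Theorems.FemtoTransferGap
open Summit.QuantumFields.YangMills.Theorems.FemtoTransferGap.TwoLattice
open Summit.QuantumFields.YangMills.Theorems.FemtoTransferGap.TwoLattice.ConstTube
open Summit.QuantumFields.YangMills.Theorems.FemtoTransferGap.TwoLattice.Avg
open Summit.QuantumFields.YangMills.Theorems.FemtoTransferGap.TwoLattice.Cov
open Summit.QuantumFields.YangMills.Theorems.FemtoTransferGap.TwoLattice.Stiff (LinkSpace)
open Summit.QuantumFields.YangMills.Theorems.FemtoCutoffLadder

variable {L : ℕ} [NeZero L]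

/-! ## ★★★★ The exact dressing from scalar profile numbers -/

/-- `E(τ, σ)` is monotone in `σ ≥ 0`. [folklore] -/
theorem stepActionErr_mono_right (τ : ℝ) {σ₁ σ₂ : ℝ} (h : σ₁ ≤ σ₂) : stepActionErr (L := L) τ σ₁ ≤ stepActionErr (L := L) τ σ₂ := by
  unfold stepActionErr
  have hs := Real.sqrt_le_sqrt h
  have hτ2 : 0 ≤ 1728 * τ ^ 2 := by positivity
  have hNP : 0 ≤ (Fintype.card (Plaquette 3 L) : ℝ) := Nat.cast_nonneg _
  exact mul_le_mul_of_nonneg_left (by nlinarith [mul_le_mul_of_nonneg_left hs hτ2]) hNP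

set_option maxHeartbeats 3200000 in
/-- ★★★★ **THE EXACT DRESSING FROM SCALAR PROFILE NUMBERS.**  Window `δ₁ = D_w·recordDelta1 L (1/6)` (`D_w ≥ 0`); FP window `ε(β) = (√β)⁻¹`; a profile family `Ω β`
(measurable, `0 ≤ Ω β ≤ CΩ β`, colour-blind, support in the capped balanced set with `‖v̂‖ ≤ R β` and coordinates `|v_{e,c}| ≤ R_τ β ≤ 1/30`, all `β`) whose coordinate radius is
compatible with the window (`β·E(R_τ β, 12L³δ₁⁴) ≤ 1` eventually); measurable fibre cores `C β ⊆ {cap, ‖v̂‖, |v_{e,c}| ≤ (√β)⁻¹}`; and, eventually in `β`, the seven scalar facts: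
`θ_β = ∫_{C β}Ω β > 0`, `∫Ω β ≤ Aθ_β`, `∫Ω β(√β‖v̂‖)^{3n} ≤ Aθ_β`, `∫Ω̃₄ ≤ Aθ_β`, `∫Ω̃₄(√β‖v̂‖)^{3n} ≤ Aθ_β` (`Ω̃₄ = Ω β·(1+β‖v̂‖²)⁴`), and the fibre tails at `T = β^{1/8}`:
`∫_{T<β‖v̂‖²}Ω β ≤ t(β)θ_β`, `∫_{T<β‖v̂‖²}Ω β(√β‖v̂‖)^{3n} ≤ t(β)θ_β` with `0 ≤ t(β) ≤ A_t·e^{−c_tβ^{1/8}}`.  THEN the conclusion of `exactDressing_fields` holds: `∃ κ ≥ 0, ε_W = O(λ_b²)`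
such that `W̃ β = clampW κ (f_β/f_β(1)) (min(d_tor,½))` is physical, `0 ≤ W̃ ≤ √(1+κ/4)`, `|W̃ β u² − 1| ≤ κ·orbitDist u²` on the window (every `β`), and `|W̃ β u² − f̂_β u| ≤ ε_W β` on the
window eventually. [cite: Luscher1983, §3] -/
theorem exactDressing_of_profileNumbers {Dw A At ct : ℝ} (hDw : 0 ≤ Dw) (hA : 0 ≤ A) (hAt : 0 ≤ At) (hct : 0 < ct)
    (Ω : ℝ → LinkSpace L → ℝ) (CΩ R Rτ t : ℝ → ℝ) (C : ℝ → Set (Edge 3 L → Fin 3 → ℝ))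
    (hΩm : ∀ β, Measurable (Ω β)) (hCΩ : ∀ β x, |Ω β x| ≤ CΩ β) (hΩ0 : ∀ β x, 0 ≤ Ω β x) (hΩinv : ∀ β (g : SU2) (x : LinkSpace L), Ω β (adL L g x) = Ω β x)
    (hΩt : ∀ β (v : Edge 3 L → Fin 3 → ℝ), Ω β (linkEmbed L v) ≠ 0 → v ∈ capBalancedSet L ∧ ‖linkEmbed L v‖ ≤ R β)
    (hRτ : ∀ᶠ β : ℝ in atTop, Rτ β ≤ 1 / 30) (hΩτ : ∀ β (v : Edge 3 L → Fin 3 → ℝ), Ω β (linkEmbed L v) ≠ 0 → ∀ (e : Edge 3 L) (c : Fin 3), |v e c| ≤ Rτ β)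
    (hE : ∀ᶠ β : ℝ in atTop, β * stepActionErr (L := L) (Rτ β) ((L : ℝ) ^ 3 * (12 * (Dw * recordDelta1 L (1 / 6) β) ^ 4)) ≤ 1)
    (hC : ∀ β, MeasurableSet (C β))
    (hCsub : ∀ β, ∀ v ∈ C β, v ∈ capBalancedSet L ∧ ‖linkEmbed L v‖ ≤ (Real.sqrt β)⁻¹ ∧ ∀ (e : Edge 3 L) (c : Fin 3), |v e c| ≤ (Real.sqrt β)⁻¹)
    (hθ : ∀ᶠ β : ℝ in atTop, 0 < ∫ v in C β, Ω β (linkEmbed L v) ∂orthoTransverse L)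
    (hI : ∀ᶠ β : ℝ in atTop, ∫ v, Ω β (linkEmbed L v) ∂orthoTransverse L ≤ A * ∫ v in C β, Ω β (linkEmbed L v) ∂orthoTransverse L)
    (hM : ∀ᶠ β : ℝ in atTop, ∫ v, Ω β (linkEmbed L v) * (Real.sqrt β * ‖linkEmbed L v‖) ^ (3 * Fintype.card {x : Site 3 L // ¬x = 0}) ∂orthoTransverse L ≤
      A * ∫ v in C β, Ω β (linkEmbed L v) ∂orthoTransverse L)
    (hI4 : ∀ᶠ β : ℝ in atTop, ∫ v, Ω β (linkEmbed L v) * (1 + β * ‖linkEmbed L v‖ ^ 2) ^ 4 ∂orthoTransverse L ≤ A * ∫ v in C β, Ω β (linkEmbed L v) ∂orthoTransverse L)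
    (hM4 : ∀ᶠ β : ℝ in atTop, ∫ v, Ω β (linkEmbed L v) * (1 + β * ‖linkEmbed L v‖ ^ 2) ^ 4 * (Real.sqrt β * ‖linkEmbed L v‖) ^ (3 * Fintype.card {x : Site 3 L // ¬x = 0}) ∂orthoTransverse L ≤
      A * ∫ v in C β, Ω β (linkEmbed L v) ∂orthoTransverse L)
    (ht0 : ∀ᶠ β : ℝ in atTop, 0 ≤ t β)
    (htail0 : ∀ᶠ β : ℝ in atTop, ∫ v in {v | β ^ ((1 : ℝ) / 8) < β * ‖linkEmbed L v‖ ^ 2}, Ω β (linkEmbed L v) ∂orthoTransverse L ≤ t β * ∫ v in C β, Ω β (linkEmbed L v) ∂orthoTransverse L)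
    (htail3 : ∀ᶠ β : ℝ in atTop, ∫ v in {v | β ^ ((1 : ℝ) / 8) < β * ‖linkEmbed L v‖ ^ 2}, Ω β (linkEmbed L v) * (Real.sqrt β * ‖linkEmbed L v‖) ^ (3 * Fintype.card {x : Site 3 L // ¬x = 0}) ∂orthoTransverse L ≤
      t β * ∫ v in C β, Ω β (linkEmbed L v) ∂orthoTransverse L)
    (htdecay : ∀ᶠ β : ℝ in atTop, t β ≤ At * Real.exp (-(ct * β ^ ((1 : ℝ) / 8)))) :
    ∃ κ : ℝ, 0 ≤ κ ∧ ∃ εW : ℝ → ℝ, (∃ a' : ℝ, ∀ᶠ β : ℝ in atTop, εW β ≤ a' * bareLambda ((L : ℝ) ^ 3 * β) ^ 2) ∧ (∀ᶠ β : ℝ in atTop, 0 ≤ εW β) ∧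
      (∀ β, IsPhys (clampW κ (fun u : GaugeConfig 3 1 SU2 => fpBOKernel L β (Ω β) (fpWeight L (Real.sqrt β)⁻¹) u u / transferKernel su2Rep ((L : ℝ) ^ 3 * β) u u /
          (fpBOKernel L β (Ω β) (fpWeight L (Real.sqrt β)⁻¹) 1 1 / transferKernel su2Rep ((L : ℝ) ^ 3 * β) (1 : GaugeConfig 3 1 SU2) 1))
        (fun U : GaugeConfig 3 1 SU2 => min (torDist U) (1 / 2)))) ∧
      (∀ β u, 0 ≤ clampW κ (fun u : GaugeConfig 3 1 SU2 => fpBOKernel L β (Ω β) (fpWeight L (Real.sqrt β)⁻¹) u u / transferKernel su2Rep ((L : ℝ) ^ 3 * β) u u /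
          (fpBOKernel L β (Ω β) (fpWeight L (Real.sqrt β)⁻¹) 1 1 / transferKernel su2Rep ((L : ℝ) ^ 3 * β) (1 : GaugeConfig 3 1 SU2) 1))
        (fun U : GaugeConfig 3 1 SU2 => min (torDist U) (1 / 2)) u) ∧
      (∀ β u, |clampW κ (fun u : GaugeConfig 3 1 SU2 => fpBOKernel L β (Ω β) (fpWeight L (Real.sqrt β)⁻¹) u u / transferKernel su2Rep ((L : ℝ) ^ 3 * β) u u /
          (fpBOKernel L β (Ω β) (fpWeight L (Real.sqrt β)⁻¹) 1 1 / transferKernel su2Rep ((L : ℝ) ^ 3 * β) (1 : GaugeConfig 3 1 SU2) 1))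
        (fun U : GaugeConfig 3 1 SU2 => min (torDist U) (1 / 2)) u| ≤ Real.sqrt (1 + κ / 4)) ∧
      (∀ β u, orbitDist u < Dw * recordDelta1 L (1 / 6) β →
        |clampW κ (fun u : GaugeConfig 3 1 SU2 => fpBOKernel L β (Ω β) (fpWeight L (Real.sqrt β)⁻¹) u u / transferKernel su2Rep ((L : ℝ) ^ 3 * β) u u /
          (fpBOKernel L β (Ω β) (fpWeight L (Real.sqrt β)⁻¹) 1 1 / transferKernel su2Rep ((L : ℝ) ^ 3 * β) (1 : GaugeConfig 3 1 SU2) 1))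
        (fun U : GaugeConfig 3 1 SU2 => min (torDist U) (1 / 2)) u ^ 2 - 1| ≤ κ * orbitDist u ^ 2) ∧
      (∀ᶠ β : ℝ in atTop, ∀ u : GaugeConfig 3 1 SU2, orbitDist u < Dw * recordDelta1 L (1 / 6) β →
        |clampW κ (fun u : GaugeConfig 3 1 SU2 => fpBOKernel L β (Ω β) (fpWeight L (Real.sqrt β)⁻¹) u u / transferKernel su2Rep ((L : ℝ) ^ 3 * β) u u /
          (fpBOKernel L β (Ω β) (fpWeight L (Real.sqrt β)⁻¹) 1 1 / transferKernel su2Rep ((L : ℝ) ^ 3 * β) (1 : GaugeConfig 3 1 SU2) 1))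
        (fun U : GaugeConfig 3 1 SU2 => min (torDist U) (1 / 2)) u ^ 2 -
          fpBOKernel L β (Ω β) (fpWeight L (Real.sqrt β)⁻¹) u u / transferKernel su2Rep ((L : ℝ) ^ 3 * β) u u /
            (fpBOKernel L β (Ω β) (fpWeight L (Real.sqrt β)⁻¹) 1 1 / transferKernel su2Rep ((L : ℝ) ^ 3 * β) (1 : GaugeConfig 3 1 SU2) 1)| ≤ εW β) := by
  haveI := isFiniteMeasure_orthoTransverse L
  have hN := card_site_pos (L := L)
  obtain ⟨Ξ₀, hΞ₀0, hΞb⟩ := profile_moment_number (L := L) hA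
  obtain ⟨Cη, hCη0, hηb⟩ := profile_reference_tail (L := L) hA
  obtain ⟨C₁, C₂, hC₁0, hC₂0, hsb⟩ := profile_slow_tail (L := L) hA one_pos
  set cδ : ℝ := Dw * 14 / Fintype.card (Site 3 L) with hcδ
  have hcδ0 : 0 ≤ cδ := by rw [hcδ]; positivity
  set n : ℕ := Fintype.card {x : Site 3 L // ¬x = 0} with hn
  -- the tail function `η`
  set η : ℝ → ℝ := fun β => Cη * (Real.exp (-(β ^ ((1 : ℝ) / 8) / 2)) + t β) +
    Real.exp 1 * (C₁ * Real.exp (-(β ^ ((1 : ℝ) / 8) / 8)) * (1 + 2 * (3 * cδ * β) ^ (3 * n)) + C₂ * t β * β ^ (3 * n + 3)) with hηdef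
  have hnum := slow_window_numerology (L := L) hDw
  -- (1) the FP budget
  have hε : ∀ᶠ β : ℝ in atTop, β * (Real.sqrt β)⁻¹ ^ 2 ≤ 1 := by filter_upwards [hnum] with β h; exact h.2.2.1
  -- (2) positivity of `f_β(1)` (floor)
  have hpos : ∀ᶠ β : ℝ in atTop, 0 < fpBOKernel L β (Ω β) (fpWeight L (Real.sqrt β)⁻¹) 1 1 / transferKernel su2Rep ((L : ℝ) ^ 3 * β) (1 : GaugeConfig 3 1 SU2) 1 := by
    filter_upwards [hnum, hθ] with β h hθβ
    obtain ⟨hs0, hs30, hs1, hβs, hβ0⟩ := inv_sqrt_window h.1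
    have hK1p : 0 < transferKernel su2Rep ((L : ℝ) ^ 3 * β) (1 : GaugeConfig 3 1 SU2) 1 := transferKernel_pos _ _ _ _
    refine div_pos ?_ hK1p
    have hfl := reference_mass_ge_floor (L := L) hβ0 (hΩm β) (hCΩ β) (hΩ0 β) (hΩt β) (hC β) hs30 (hCsub β) (Real.sqrt β)⁻¹ hs0 hs1
    have hZ : 0 < fpZ (Real.sqrt β)⁻¹ := fpZ_pos hs0
    have hfl0 : 0 < transferKernel su2Rep ((L : ℝ) ^ 3 * β) (1 : GaugeConfig 3 1 SU2) 1 *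
        (Real.exp (-(β * ((Fintype.card (Edge 3 L) : ℝ) * (2 * (Real.sqrt β)⁻¹ + 2 * Real.sqrt 2 * (Real.sqrt β)⁻¹) ^ 2)) -
              β / 2 * (((10 * Real.sqrt (Fintype.card (Plaquette 3 L × Fin 3)) * (Real.sqrt β)⁻¹) ^ 2 + stepActionErr (L := L) (Real.sqrt β)⁻¹ 0) +
                ((10 * Real.sqrt (Fintype.card (Plaquette 3 L × Fin 3)) * (Real.sqrt β)⁻¹) ^ 2 + stepActionErr (L := L) (Real.sqrt β)⁻¹ 0))) *
          (fpZ (Real.sqrt β)⁻¹ * ((Real.sqrt β)⁻¹ ^ 3 / 10) ^ Fintype.card {x : Site 3 L // ¬x = 0} * (∫ v in C β, Ω β (linkEmbed L v) ∂orthoTransverse L) ^ 2)) := by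
      have := Real.exp_pos (-(β * ((Fintype.card (Edge 3 L) : ℝ) * (2 * (Real.sqrt β)⁻¹ + 2 * Real.sqrt 2 * (Real.sqrt β)⁻¹) ^ 2)) -
              β / 2 * (((10 * Real.sqrt (Fintype.card (Plaquette 3 L × Fin 3)) * (Real.sqrt β)⁻¹) ^ 2 + stepActionErr (L := L) (Real.sqrt β)⁻¹ 0) +
                ((10 * Real.sqrt (Fintype.card (Plaquette 3 L × Fin 3)) * (Real.sqrt β)⁻¹) ^ 2 + stepActionErr (L := L) (Real.sqrt β)⁻¹ 0)))
      positivity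
    rw [fpBOKernel_eq_integral_prod β (hΩm β) (hCΩ β) (measurable_fpWeight L (Real.sqrt β)⁻¹) (abs_fpWeight_le L (Real.sqrt β)⁻¹)]
    exact lt_of_lt_of_le hfl0 hfl
  -- (3) the moment number
  have hΞ : ∀ᶠ β : ℝ in atTop, ∃ Ξ : ℝ, 0 ≤ Ξ ∧ Ξ ≤ Ξ₀ ∧
      ∫ p in ({p : (Edge 3 L → Fin 3 → ℝ) × ((Edge 3 L → Fin 3 → ℝ) × (Site 3 L → SU2)) | β * kinDefect L (orthoTube L 1 p.1) (orthoTube L 1 p.2.1) p.2.2 ≤ β ^ ((1 : ℝ) / 8)} ∩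
          {p | β * ‖linkEmbed L p.1‖ ^ 2 ≤ β ^ ((1 : ℝ) / 8)} ∩ {p | β * ‖linkEmbed L p.2.1‖ ^ 2 ≤ β ^ ((1 : ℝ) / 8)} ∩
          {p | Ω β (linkEmbed L p.1) ≠ 0 ∧ Ω β (linkEmbed L p.2.1) ≠ 0 ∧ fpWeight L (Real.sqrt β)⁻¹ p.2.2 ≠ 0}),
        fpTriple L β (Ω β) (fpWeight L (Real.sqrt β)⁻¹) 1 1 p * (1 + β * kinDefect L (orthoTube L 1 p.1) (orthoTube L 1 p.2.1) p.2.2 + β * ‖linkEmbed L p.1‖ ^ 2 + β * ‖linkEmbed L p.2.1‖ ^ 2) ^ 4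
        ∂((orthoTransverse L).prod ((orthoTransverse L).prod (gaugeMeasure L))) ≤
      Ξ * ∫ p, fpTriple L β (Ω β) (fpWeight L (Real.sqrt β)⁻¹) 1 1 p ∂((orthoTransverse L).prod ((orthoTransverse L).prod (gaugeMeasure L))) := by
    filter_upwards [hnum, hθ, hI4, hM4] with β h hθβ hI4β hM4β
    obtain ⟨hs0, -, -, -, -⟩ := inv_sqrt_window h.1
    exact ⟨Ξ₀, hΞ₀0, le_rfl, hΞb h.1 (hΩm β) (hCΩ β) (hΩ0 β) (hΩt β) hs0 (hC β) (hCsub β) hθβ hI4β hM4β (β ^ ((1 : ℝ) / 8))⟩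
  -- (4) the reference tail
  have hη1 : ∀ᶠ β : ℝ in atTop,
      ∫ p in ({p : (Edge 3 L → Fin 3 → ℝ) × ((Edge 3 L → Fin 3 → ℝ) × (Site 3 L → SU2)) | β * kinDefect L (orthoTube L 1 p.1) (orthoTube L 1 p.2.1) p.2.2 ≤ β ^ ((1 : ℝ) / 8)} ∩
          {p | β * ‖linkEmbed L p.1‖ ^ 2 ≤ β ^ ((1 : ℝ) / 8)} ∩ {p | β * ‖linkEmbed L p.2.1‖ ^ 2 ≤ β ^ ((1 : ℝ) / 8)} ∩
          {p | Ω β (linkEmbed L p.1) ≠ 0 ∧ Ω β (linkEmbed L p.2.1) ≠ 0 ∧ fpWeight L (Real.sqrt β)⁻¹ p.2.2 ≠ 0})ᶜ,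
        fpTriple L β (Ω β) (fpWeight L (Real.sqrt β)⁻¹) 1 1 p ∂((orthoTransverse L).prod ((orthoTransverse L).prod (gaugeMeasure L))) ≤
      η β * ∫ p, fpTriple L β (Ω β) (fpWeight L (Real.sqrt β)⁻¹) 1 1 p ∂((orthoTransverse L).prod ((orthoTransverse L).prod (gaugeMeasure L))) := by
    filter_upwards [hnum, hθ, hI, hM, ht0, htail0, htail3] with β h hθβ hIβ hMβ ht0β ht1 ht2
    obtain ⟨hs0, -, -, -, hβ0⟩ := inv_sqrt_window h.1
    have hb := hηb h.1 (hΩm β) (hCΩ β) (hΩ0 β) (hΩt β) hs0 (hC β) (hCsub β) hθβ hIβ hMβ (β ^ ((1 : ℝ) / 8)) ht0β ht1 ht2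
    refine hb.trans (mul_le_mul_of_nonneg_right ?_ (integral_nonneg fun p => ?_))
    · rw [hηdef]; dsimp only
      have : 0 ≤ Real.exp 1 * (C₁ * Real.exp (-(β ^ ((1 : ℝ) / 8) / 8)) * (1 + 2 * (3 * cδ * β) ^ (3 * n)) + C₂ * t β * β ^ (3 * n + 3)) := by positivity
      linarith only [this]
    · unfold fpTriple; exact mul_nonneg (hΩ0 β _) (mul_nonneg (mul_nonneg (fpWeight_mem_Icc L _ _).1 (transferKernel_pos _ _ _ _).le) (hΩ0 β _))
  -- (5) the slow tail
  have hηu : ∀ᶠ β : ℝ in atTop, ∀ u : GaugeConfig 3 1 SU2, orbitDist u < Dw * recordDelta1 L (1 / 6) β → ∀ d : SU2,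
      (∫ p in ({p : (Edge 3 L → Fin 3 → ℝ) × ((Edge 3 L → Fin 3 → ℝ) × (Site 3 L → SU2)) | β * kinDefect L (orthoTube L 1 p.1) (orthoTube L 1 p.2.1) p.2.2 ≤ β ^ ((1 : ℝ) / 8)} ∩
          {p | β * ‖linkEmbed L p.1‖ ^ 2 ≤ β ^ ((1 : ℝ) / 8)} ∩ {p | β * ‖linkEmbed L p.2.1‖ ^ 2 ≤ β ^ ((1 : ℝ) / 8)} ∩
          {p | Ω β (linkEmbed L p.1) ≠ 0 ∧ Ω β (linkEmbed L p.2.1) ≠ 0 ∧ fpWeight L (Real.sqrt β)⁻¹ p.2.2 ≠ 0})ᶜ,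
        fpTriple L β (Ω β) (fpWeight L (Real.sqrt β)⁻¹) (gaugeTransform (fun _ : Site 3 1 => d) u) (gaugeTransform (fun _ : Site 3 1 => d) u) p
        ∂((orthoTransverse L).prod ((orthoTransverse L).prod (gaugeMeasure L)))) / transferKernel su2Rep ((L : ℝ) ^ 3 * β) u u ≤
      η β * ((∫ p, fpTriple L β (Ω β) (fpWeight L (Real.sqrt β)⁻¹) 1 1 p ∂((orthoTransverse L).prod ((orthoTransverse L).prod (gaugeMeasure L)))) /
        transferKernel su2Rep ((L : ℝ) ^ 3 * β) (1 : GaugeConfig 3 1 SU2) 1) := by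
    filter_upwards [hnum, hθ, hI, hM, ht0, htail0, hE, hRτ] with β h hθβ hIβ hMβ ht0β ht1 hEβ hRτβ u hu d
    obtain ⟨hβ9, hs2, -, hD0, hexpD, hwin⟩ := h
    obtain ⟨hs0, -, -, -, hβ0⟩ := inv_sqrt_window hβ9
    have hβ1 : 1 ≤ β := by linarith
    obtain ⟨hσu, hsm, htw, hTD, hsβ⟩ := hwin u hu
    have hb := hsb hβ9 (hΩm β) (hCΩ β) (hΩ0 β) (hΩt β) hRτβ (hΩτ β) (le_of_eq (one_mul _)) hs2 (hC β) (hCsub β) hθβ hIβ hMβ (β ^ ((1 : ℝ) / 8)) hD0 ht0β ht1 u hσu hsm htw hTD d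
    rw [hexpD] at hb
    refine hb.trans (mul_le_mul_of_nonneg_right ?_ ?_)
    swap
    · refine div_nonneg (integral_nonneg fun p => ?_) (transferKernel_pos _ _ _ _).le
      unfold fpTriple; exact mul_nonneg (hΩ0 β _) (mul_nonneg (mul_nonneg (fpWeight_mem_Icc L _ _).1 (transferKernel_pos _ _ _ _).le) (hΩ0 β _))
    -- `e^{βE(R_τ,σ_u)} ≤ e`, `(√β·3τ)^{3n} ≤ (3c_δβ)^{3n}`, `(√β)^{3n+3} ≤ β^{3n+3}`
    have hτ0 : 0 ≤ orbitDist u := orbitDist_nonneg u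
    have hσle : (L : ℝ) ^ 3 * (12 * orbitDist u ^ 4) ≤ (L : ℝ) ^ 3 * (12 * (Dw * recordDelta1 L (1 / 6) β) ^ 4) :=
      mul_le_mul_of_nonneg_left (mul_le_mul_of_nonneg_left (pow_le_pow_left₀ hτ0 hu.le 4) (by norm_num)) (by positivity)
    have hE1 : Real.exp (β * stepActionErr (L := L) (Rτ β) ((L : ℝ) ^ 3 * (12 * orbitDist u ^ 4))) ≤ Real.exp 1 := by
      refine Real.exp_le_exp.mpr (le_trans ?_ hEβ)
      exact mul_le_mul_of_nonneg_left (stepActionErr_mono_right (L := L) (Rτ β) hσle) hβ0.le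
    have hX : (Real.sqrt β * (3 * orbitDist u)) ^ (3 * n) ≤ (3 * cδ * β) ^ (3 * n) := pow_le_pow_left₀ (by positivity) (by rw [hcδ]; exact hsβ) _
    have hsq : Real.sqrt β ^ (3 * n + 3) ≤ β ^ (3 * n + 3) := pow_le_pow_left₀ (Real.sqrt_nonneg _) (sqrt_le_self_of_one_le hβ1) _
    have hin : C₁ * Real.exp (-(β ^ ((1 : ℝ) / 8) / 8)) * (1 + 2 * (Real.sqrt β * (3 * orbitDist u)) ^ (3 * n)) + C₂ * t β * Real.sqrt β ^ (3 * n + 3) ≤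
        C₁ * Real.exp (-(β ^ ((1 : ℝ) / 8) / 8)) * (1 + 2 * (3 * cδ * β) ^ (3 * n)) + C₂ * t β * β ^ (3 * n + 3) := by
      have h1 := mul_le_mul_of_nonneg_left (by linarith only [hX] : 1 + 2 * (Real.sqrt β * (3 * orbitDist u)) ^ (3 * n) ≤ 1 + 2 * (3 * cδ * β) ^ (3 * n))
        (by positivity : 0 ≤ C₁ * Real.exp (-(β ^ ((1 : ℝ) / 8) / 8)))
      have h2 := mul_le_mul_of_nonneg_left hsq (by positivity : 0 ≤ C₂ * t β)
      linarith only [h1, h2]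
    have hin0 : 0 ≤ C₁ * Real.exp (-(β ^ ((1 : ℝ) / 8) / 8)) * (1 + 2 * (Real.sqrt β * (3 * orbitDist u)) ^ (3 * n)) + C₂ * t β * Real.sqrt β ^ (3 * n + 3) := by positivity
    calc Real.exp (β * stepActionErr (L := L) (Rτ β) ((L : ℝ) ^ 3 * (12 * orbitDist u ^ 4))) *
          (C₁ * Real.exp (-(β ^ ((1 : ℝ) / 8) / 8)) * (1 + 2 * (Real.sqrt β * (3 * orbitDist u)) ^ (3 * n)) + C₂ * t β * Real.sqrt β ^ (3 * n + 3))
        ≤ Real.exp 1 * (C₁ * Real.exp (-(β ^ ((1 : ℝ) / 8) / 8)) * (1 + 2 * (3 * cδ * β) ^ (3 * n)) + C₂ * t β * β ^ (3 * n + 3)) := mul_le_mul hE1 hin hin0 (Real.exp_pos 1).le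
      _ ≤ η β := by
          rw [hηdef]; dsimp only
          have : 0 ≤ Cη * (Real.exp (-(β ^ ((1 : ℝ) / 8) / 2)) + t β) := by positivity
          linarith only [this]
  -- (6) `0 ≤ η`, `η = O(λ_b²)`
  have hη0 : ∀ᶠ β : ℝ in atTop, 0 ≤ η β := by
    filter_upwards [ht0, Filter.eventually_ge_atTop (0 : ℝ)] with β ht0β hβ0
    rw [hηdef]; dsimp only; positivity
  have hηa : ∀ᶠ β : ℝ in atTop, η β ≤ ((L : ℝ) ^ 2 * (Cη * (1 + At) + Real.exp 1 * (C₁ * (1 + 2 * (3 * cδ) ^ (3 * n)) + C₂ * At))) * bareLambda ((L : ℝ) ^ 3 * β) ^ 2 := by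
    have d1 := exp_neg_rpow_eighth_mul_pow_le (show (0 : ℝ) < 1 / 2 by norm_num) 0
    have d2 := exp_neg_rpow_eighth_mul_pow_le hct 0
    have d3 := exp_neg_rpow_eighth_mul_pow_le (show (0 : ℝ) < 1 / 8 by norm_num) 0
    have d4 := exp_neg_rpow_eighth_mul_pow_le (show (0 : ℝ) < 1 / 8 by norm_num) (3 * n)
    have d5 := exp_neg_rpow_eighth_mul_pow_le hct (3 * n + 3)
    filter_upwards [d1, d2, d3, d4, d5, ht0, htdecay, Filter.eventually_ge_atTop (1 : ℝ)] with β e1 e2 e3 e4 e5 ht0β htd hβ1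
    have hβ0 : 0 < β := by linarith
    simp only [pow_zero, mul_one] at e1 e2 e3
    have hm := rpow_neg_three_quarters_le_bareLambda_sq (L := L) hβ1
    set m : ℝ := β ^ (-((3 : ℝ) / 4)) with hmdef
    have hm0 : 0 ≤ m := (Real.rpow_pos_of_pos hβ0 _).le
    have f1 : Real.exp (-(β ^ ((1 : ℝ) / 8) / 2)) ≤ m := by
      have : -(β ^ ((1 : ℝ) / 8) / 2) = -(1 / 2 * β ^ ((1 : ℝ) / 8)) := by ring
      rw [this]; exact e1
    have f2 : t β ≤ At * m := htd.trans (mul_le_mul_of_nonneg_left e2 hAt)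
    have f3 : Real.exp (-(β ^ ((1 : ℝ) / 8) / 8)) ≤ m := by
      have : -(β ^ ((1 : ℝ) / 8) / 8) = -(1 / 8 * β ^ ((1 : ℝ) / 8)) := by ring
      rw [this]; exact e3
    have f4 : Real.exp (-(β ^ ((1 : ℝ) / 8) / 8)) * β ^ (3 * n) ≤ m := by
      have : -(β ^ ((1 : ℝ) / 8) / 8) = -(1 / 8 * β ^ ((1 : ℝ) / 8)) := by ring
      rw [this]; exact e4
    have f5 : t β * β ^ (3 * n + 3) ≤ At * m := by
      calc t β * β ^ (3 * n + 3) ≤ At * Real.exp (-(ct * β ^ ((1 : ℝ) / 8))) * β ^ (3 * n + 3) := mul_le_mul_of_nonneg_right htd (by positivity)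
        _ = At * (Real.exp (-(ct * β ^ ((1 : ℝ) / 8))) * β ^ (3 * n + 3)) := by ring
        _ ≤ At * m := mul_le_mul_of_nonneg_left e5 hAt
    have hc3 : 0 ≤ (3 * cδ) ^ (3 * n) := by positivity
    have f34 : Real.exp (-(β ^ ((1 : ℝ) / 8) / 8)) * (1 + 2 * (3 * cδ * β) ^ (3 * n)) ≤ (1 + 2 * (3 * cδ) ^ (3 * n)) * m := by
      rw [mul_pow]
      have g := mul_le_mul_of_nonneg_left f4 hc3
      have e1 : Real.exp (-(β ^ ((1 : ℝ) / 8) / 8)) * (1 + 2 * ((3 * cδ) ^ (3 * n) * β ^ (3 * n))) =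
          Real.exp (-(β ^ ((1 : ℝ) / 8) / 8)) + 2 * ((3 * cδ) ^ (3 * n) * (Real.exp (-(β ^ ((1 : ℝ) / 8) / 8)) * β ^ (3 * n))) := by ring
      have e2 : (1 + 2 * (3 * cδ) ^ (3 * n)) * m = m + 2 * ((3 * cδ) ^ (3 * n) * m) := by ring
      rw [e1, e2]; linarith only [f3, g]
    rw [hηdef]; dsimp only
    have hsum : Cη * (Real.exp (-(β ^ ((1 : ℝ) / 8) / 2)) + t β) + Real.exp 1 * (C₁ * Real.exp (-(β ^ ((1 : ℝ) / 8) / 8)) * (1 + 2 * (3 * cδ * β) ^ (3 * n)) + C₂ * t β * β ^ (3 * n + 3)) ≤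
        (Cη * (1 + At) + Real.exp 1 * (C₁ * (1 + 2 * (3 * cδ) ^ (3 * n)) + C₂ * At)) * m := by
      have g1 : Cη * (Real.exp (-(β ^ ((1 : ℝ) / 8) / 2)) + t β) ≤ Cη * ((1 + At) * m) := mul_le_mul_of_nonneg_left (by linarith only [f1, f2]) hCη0
      have g2 : C₁ * Real.exp (-(β ^ ((1 : ℝ) / 8) / 8)) * (1 + 2 * (3 * cδ * β) ^ (3 * n)) ≤ C₁ * ((1 + 2 * (3 * cδ) ^ (3 * n)) * m) := by
        rw [mul_assoc]; exact mul_le_mul_of_nonneg_left f34 hC₁0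
      have g3 : C₂ * t β * β ^ (3 * n + 3) ≤ C₂ * (At * m) := by rw [mul_assoc]; exact mul_le_mul_of_nonneg_left f5 hC₂0
      have g23 := mul_le_mul_of_nonneg_left (add_le_add g2 g3) (Real.exp_pos 1).le
      linarith only [g1, g23]
    refine hsum.trans ?_
    have hK0 : 0 ≤ Cη * (1 + At) + Real.exp 1 * (C₁ * (1 + 2 * (3 * cδ) ^ (3 * n)) + C₂ * At) := by positivity
    calc (Cη * (1 + At) + Real.exp 1 * (C₁ * (1 + 2 * (3 * cδ) ^ (3 * n)) + C₂ * At)) * m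
        ≤ (Cη * (1 + At) + Real.exp 1 * (C₁ * (1 + 2 * (3 * cδ) ^ (3 * n)) + C₂ * At)) * ((L : ℝ) ^ 2 * bareLambda ((L : ℝ) ^ 3 * β) ^ 2) := mul_le_mul_of_nonneg_left hm hK0
      _ = (L : ℝ) ^ 2 * (Cη * (1 + At) + Real.exp 1 * (C₁ * (1 + 2 * (3 * cδ) ^ (3 * n)) + C₂ * At)) * bareLambda ((L : ℝ) ^ 3 * β) ^ 2 := by ring
  exact exactDressing_fields (L := L) hDw zero_le_one hΞ₀0 Ω CΩ (fun β => (Real.sqrt β)⁻¹) η hΩm hCΩ hΩ0 hΩinv (fun β v hv => (hΩt β v hv).1) hε hpos hΞ hη1 hηu hη0 hηa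

end Summit.QuantumFields.YangMills.Theorems.FemtoTransferGap.RateTube

end
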